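import Summits.MatrixMultiplication.MatrixMultiplication.Theorems.FarEdgeDescentSpectralWorlds
import HarnessLib

/-!
# FarEdgeDescent — 3D-LAWFUL SPECTRAL WORLDS (II): the slack world `W_slack`

`W_slack(a,b,c) := max(Σ − m, (6Σ + 3M)/10)` (`Σ = a+b+c`, `m = min`, `M = max`): the support function of
`conv(T ∪ S₃·(3/5,9/10,3/5))`.  Laws as in `FarEdgeDescentSpectralWorlds` (symmetry, homogeneity,
subadditivity, convex combinations, monotonicity, sandwich).  Pencil: `α_W = 5/6`, `ω_W = 21/10`, first zero
`β_W = 2` (transversal, slope `9/10`; corner at `α_W` of slope `3/5`), and the FOLD THRESHOLD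
`2/α_W − 1 = 7/5 < β_W` is UNSATURATED: `FiniteSaturation`-shape holds but the world is NOT fold-tight.
With `FarEdgeDescentFoldCoupling` (`S ⟹ FoldTight ⟹ FiniteSaturation`) and `W_poly` (fold-tight, `¬S`-like)
this makes BOTH steps of the dial strict in 3D-lawful, theorem-compatible worlds (VXXZ table,
`ω(1,1/3,5/3) = 8/3`, Coppersmith tight shapes all checked below).  Cell [N2 ∧ W2 ∧ slack].
-/

set_option linter.dupNamespace false

noncomputable section

namespace Summit.MatrixMultiplication.MatrixMultiplication.Theorems.FarEdgeDescentSpectralSlack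

open Literature.Computability.AlgebraicComplexity
open Summit.MatrixMultiplication.MatrixMultiplication.Theorems.FarEdgeDescentSpectralWorlds
open Filter Topology Set

/-! ## §2 The SLACK world `W_slack` — dark orbit of `(3/5, 9/10, 3/5)`

`W_slack(a,b,c) := max( Σ − m , (6Σ + 3M)/10 )`, `M := max(a,b,c)`: support function of
`conv(T ∪ S₃·(3/5,9/10,3/5))`.  Pencil: `α_W = 5/6`, `ω_W = 21/10`, first zero `β_W = 2` (transversal, slope
`9/10`), fold threshold `2/α_W − 1 = 7/5 < β_W`: `FiniteSaturation`-shape holds but the world is NOT fold-tight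
(`W(1,7/5,1) = 123/50 ≠ 12/5`) — the dial step `FoldTight ⟹ FiniteSaturation` is strict. -/

section Slack

variable {W : ℝ → ℝ → ℝ → ℝ}
  (hW : ∀ a b c : ℝ, W a b c =
    max (a + b + c - min a (min b c)) ((6 * (a + b + c) + 3 * max a (max b c)) / 10))
include hW

/-- THE 3D LAWS of `W_slack` (bundled): `S₃`-symmetry (two generating transpositions), positive
homogeneity, subadditivity (on all of `ℝ³`), joint convexity (convex-combination form), monotonicity in the
first (hence every) argument, and the sandwich `max(a+b,b+c,c+a) ≤ W ≤ a+b+c` on `ℝ³₊`. -/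
theorem slack_laws :
    (∀ a b c : ℝ, W a b c = W b c a ∧ W a b c = W b a c) ∧
    (∀ ν : ℝ, 0 ≤ ν → ∀ a b c : ℝ, W (ν * a) (ν * b) (ν * c) = ν * W a b c) ∧
    (∀ a b c a' b' c' : ℝ, W (a + a') (b + b') (c + c') ≤ W a b c + W a' b' c') ∧
    (∀ s t : ℝ, 0 ≤ s → 0 ≤ t → ∀ a b c a' b' c' : ℝ,
      W (s * a + t * a') (s * b + t * b') (s * c + t * c') ≤ s * W a b c + t * W a' b' c') ∧
    (∀ a a' : ℝ, a ≤ a' → ∀ b c : ℝ, W a b c ≤ W a' b c) ∧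
    (∀ a b c : ℝ, 0 ≤ a → 0 ≤ b → 0 ≤ c →
      max (a + b) (max (b + c) (c + a)) ≤ W a b c ∧ W a b c ≤ a + b + c) := by
  have hom : ∀ ν : ℝ, 0 ≤ ν → ∀ a b c : ℝ, W (ν * a) (ν * b) (ν * c) = ν * W a b c := by
    intro ν hν a b c
    rw [hW, hW, min3_mul hν, max3_mul hν, mul_max_of_nonneg (a + b + c - min a (min b c)) _ hν]
    congr 1 <;> ring
  have subadd : ∀ a b c a' b' c' : ℝ, W (a + a') (b + b') (c + c') ≤ W a b c + W a' b' c' := by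
    intro a b c a' b' c'
    rw [hW, hW, hW]
    have h := min3_superadd a b c a' b' c'
    have h' := max3_subadd a b c a' b' c'
    exact max_subadd_of_le (by linarith) (by linarith)
  refine ⟨fun a b c => ?_, hom, subadd, fun s t hs ht a b c a' b' c' => ?_, fun a a' h b c => ?_,
    fun a b c ha hb hc => ?_⟩
  · refine ⟨?_, ?_⟩ <;> rw [hW, hW] <;> ac_rfl
  · rw [← hom s hs, ← hom t ht]
    exact subadd _ _ _ _ _ _
  · rw [hW, hW]
    have h1 : min a' (min b c) ≤ min a (min b c) + (a' - a) := by
      rcases le_total a (min b c) with h0 | h0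
      · rw [min_eq_left h0]; linarith [min3_le₁ a' b c]
      · rw [min_eq_right h0]; linarith [min_le_right a' (min b c)]
    have h2 := max3_mono₁ h b c
    exact max_le_max (by linarith) (by linarith)
  · rw [hW, ← sum_sub_min3]
    have hm : 0 ≤ min a (min b c) := le_min ha (le_min hb hc)
    have hM : max a (max b c) ≤ a + b + c := max_le (by linarith) (max_le (by linarith) (by linarith))
    exact ⟨le_max_left _ _, max_le (by linarith) (by linarith)⟩

/-- PENCIL, one formula on `[0, ∞)`-relevant range (valid for all `x`):
`W_slack(1,x,1) = max(2, x+1, (6x+15)/10, (9x+12)/10)`. -/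
theorem slack_pencil (x : ℝ) :
    W 1 x 1 = max (max 2 (x + 1)) (max ((6 * x + 15) / 10) ((9 * x + 12) / 10)) := by
  rw [hW]
  rcases le_total x 1 with h | h
  · have hm : min (1 : ℝ) (min x 1) = x := by rw [min_eq_left h, min_eq_right h]
    have hM : max (1 : ℝ) (max x 1) = 1 := by rw [max_eq_right h, max_self]
    rw [hm, hM, max_eq_left (by linarith : x + 1 ≤ 2),
      max_eq_left (by linarith : (9 * x + 12) / 10 ≤ (6 * x + 15) / 10)]
    congr 1 <;> ring
  · have hm : min (1 : ℝ) (min x 1) = 1 := by rw [min_eq_right h, min_self]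
    have hM : max (1 : ℝ) (max x 1) = x := by rw [max_eq_left h, max_eq_right h]
    rw [hm, hM, max_eq_right (by linarith : 2 ≤ x + 1),
      max_eq_right (by linarith : (6 * x + 15) / 10 ≤ (9 * x + 12) / 10)]
    congr 1 <;> ring

/-- Landmarks `α_W = 5/6`, `ω_W = 21/10`, `β_W = 2`; atoms N2 (corner of slope `3/5`) and W2 (transversal
landing at `2`, slope `9/10`); `FiniteSaturation`-shape (`k = 2`) but NOT fold-tight: the fold threshold
`7/5` (`α_W·(7/5 + 1) = 2`) is unsaturated.  So `FiniteSaturation ⊬ FoldTight` in 3D-lawful worlds. -/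
theorem slack_facts :
    (W 1 (5 / 6) 1 = 2 ∧ (∀ x : ℝ, 5 / 6 < x → 2 < W 1 x 1) ∧ W 1 1 1 = 21 / 10) ∧
    (∀ x : ℝ, 2 + 3 / 5 * (x - 5 / 6) ≤ W 1 x 1) ∧
    ((∀ y : ℝ, 2 ≤ y → W 1 y 1 = y + 1) ∧
      ∀ x : ℝ, 1 ≤ x → x ≤ 2 → W 1 2 1 - 9 / 10 * (2 - x) ≤ W 1 x 1) ∧
    (∃ k : ℕ, 2 ≤ k ∧ W 1 k 1 = k + 1) ∧
    ((5 / 6 : ℝ) * (7 / 5 + 1) = 2 ∧ W 1 (7 / 5) 1 ≠ 7 / 5 + 1) ∧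
    (∀ b : ℝ, (5 / 6 : ℝ) * (b + 1) = 2 → W 1 b 1 ≠ b + 1) := by
  have P := slack_pencil hW
  refine ⟨⟨?_, fun x hx => ?_, ?_⟩, fun x => ?_, ⟨fun y hy => ?_, fun x hx1 hx2 => ?_⟩,
    ⟨2, le_rfl, ?_⟩, ⟨by norm_num, ?_⟩, fun b hb => ?_⟩
  · rw [P]; norm_num [max_def]
  · rw [P]
    have : 2 < (6 * x + 15) / 10 := by linarith
    exact lt_of_lt_of_le this ((le_max_left _ _).trans (le_max_right _ _))
  · rw [P]; norm_num [max_def]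
  · rw [P]
    have : 2 + 3 / 5 * (x - 5 / 6) = (6 * x + 15) / 10 := by ring
    rw [this]
    exact (le_max_left _ _).trans (le_max_right _ _)
  · rw [P, max_eq_right (by linarith : 2 ≤ y + 1),
      max_eq_right (by linarith : (6 * y + 15) / 10 ≤ (9 * y + 12) / 10),
      max_eq_left (by linarith : (9 * y + 12) / 10 ≤ y + 1)]
  · have h2 : W 1 2 1 = 3 := by rw [P]; norm_num [max_def]
    have hx : (9 * x + 12) / 10 ≤ W 1 x 1 := by
      rw [P]; exact (le_max_right _ _).trans (le_max_right _ _)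
    rw [h2]
    linarith
  · rw [show ((2 : ℕ) : ℝ) = 2 by norm_num, P]; norm_num [max_def]
  · rw [P]; norm_num [max_def]
  · have hb' : b = 7 / 5 := by linarith
    subst hb'
    rw [P]; norm_num [max_def]

/-- THEOREM-COMPATIBILITY of `W_slack`: the VXXZ 2024 table, `ω(1,1/3,5/3) = 8/3`, Coppersmith tight shapes
(uniform length `r = 2`). -/
theorem slack_compat :
    (∀ κ b : ℝ, (κ, b) ∈ vxxz2024Table → W 1 κ 1 ≤ b) ∧
    W 1 (1 / 3) (5 / 3) = 8 / 3 ∧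
    (∀ t : ℝ, 0 ≤ t → t ≤ 1 → ∀ r : ℝ, 2 ≤ r → W 1 t r = 1 + r) := by
  refine ⟨fun κ b h => ?_, ?_, fun t ht0 ht1 r hr => ?_⟩
  · simp only [vxxz2024Table, List.mem_cons, Prod.mk.injEq, List.not_mem_nil, or_false] at h
    rcases h with ⟨rfl, rfl⟩ | ⟨rfl, rfl⟩ | ⟨rfl, rfl⟩ | ⟨rfl, rfl⟩ | ⟨rfl, rfl⟩ | ⟨rfl, rfl⟩ |
      ⟨rfl, rfl⟩ | ⟨rfl, rfl⟩ | ⟨rfl, rfl⟩ | ⟨rfl, rfl⟩ | ⟨rfl, rfl⟩ | ⟨rfl, rfl⟩ | ⟨rfl, rfl⟩ |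
      ⟨rfl, rfl⟩ | ⟨rfl, rfl⟩ | ⟨rfl, rfl⟩ | ⟨rfl, rfl⟩ | ⟨rfl, rfl⟩ | ⟨rfl, rfl⟩ | ⟨rfl, rfl⟩ |
      ⟨rfl, rfl⟩ | ⟨rfl, rfl⟩ | ⟨rfl, rfl⟩ | ⟨rfl, rfl⟩
    all_goals (rw [slack_pencil hW]; norm_num [max_def])
  · rw [hW]; norm_num [min_def, max_def]
  · rw [hW]
    have hm : min (1 : ℝ) (min t r) = t := by
      rw [min_eq_left (by linarith : t ≤ r), min_eq_right ht1]
    have hM : max (1 : ℝ) (max t r) = r := by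
      rw [max_eq_right (by linarith : t ≤ r), max_eq_right (by linarith : (1 : ℝ) ≤ r)]
    rw [hm, hM, max_eq_left (by linarith)]
    linarith

end Slack

end Summit.MatrixMultiplication.MatrixMultiplication.Theorems.FarEdgeDescentSpectralSlack
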